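import Summits.QuantumFields.YangMills.Theorems.BalabanUVNodesN22KernelLimitOfActivitySlots
import Summits.QuantumFields.YangMills.Theorems.BalabanUVNodesN22WindowSoftTwoPointAtRecord
import Summits.QuantumFields.YangMills.Theorems.BalabanUVNodesN27ReadOutAtU3OfKernels

/-!
# NODE N22 (NE9) — THE ROW CLOSED MODULO ACTIVITY-LEVEL INPUTS: `N22At` BY NAME at the kernel-pinned reading of record, the kernel-currency `h9`, and the (D4) clause
# `KernelDecayOfRecord₁₃`, with the (1.21)-existence letter DISCHARGED — activity slots + complexified reading + p. 282 tails + (S≈) + W1-20's law, nothing else at kernel level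

Cell `pub-ymgap`, Track A (HUMAN RULING D-0062), WIDTH SEAT `dag-n22-w3` g3 on node n22 = NE9; `--kind proof --supports stmt-QuantumFields-20544 --as helper` (K3⁷
`SpineGivenEndpointR13SepCoPH`, skeleton v5 941dddb108cbaacf), COUNT-NEUTRAL.  The closing knit of this seat's CLAIM-2 («existence half») with dag-n22-w2 g3's (B)
`…N22WindowSoftTwoPointAtRecord` (p606885, the (t8) lever at the record): (B)'s three record theorems take W1-19b's `PolLimitsExistOfRecord₁₃ F N θ` as a DISPLAYED hypothesis
(`hlim`; n22-w2 INBOX l.28861 «for your file to fill BY NAME»); this seat's `polLimitsExistOfRecord₁₃_of_activitySlots` (`…N22KernelLimitOfActivitySlots`) produces it from the SAME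
activity-level data plus the approximate cross-volume stability (S≈).  ONE application each:

* `ne9_EA_objectsOfRecord₁₃_of_activitySlots_of_approxStable` — K3⁷ v5 §2b's raw input `h9 : NE9 ((objectsOfRecord₁₃ F N θ ℓ).EA 0) (Window θ.γ) ℓ.κ ℓ.moduli`;
* `kernelDecayOfRecord₁₃_of_activitySlots_of_approxStable` — §2b's `hdec : KernelDecayOfRecord₁₃ F N θ μ ν κ′` at any `κ′ ≤ δ₁` (VALUE slot only);
* ★★★ `n22At_rateCarriers_of_kernels_pin_of_activitySlots_of_approxStable` — the N22 conjunct `N22At (rateCarriersOfRecord₁₃CoPH 𝔯 F θ hP g₀ os k).u3` of `RatesHolderAt` at a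
  reading PINNED to the kernel objects of record (K3⁷ v5 `U3PinnedKernels` at the tuple), EVERY run length `k`;
* ★★★ `readOutAt_rateCarriers_of_kernels_pin_of_activitySlots_of_approxStable` — the OTHER node-U3 conjunct of `KeyedRatesHolderD4`'s body, the (D4) READ-OUT face
  `ReadOutAt (datumOfRecord₁₃CoPH F N θ hP) (rateCarriersOfRecord₁₃CoPH 𝔯 F θ hP g₀ os k).u3`, EVERY `k`, VALUE slot only (dag-n27-w1 `readOutAt_objectsOfRecord₁₃_coPH` p591653 ∘
  `kernelDecayOfRecord₁₃_of_activitySlots_of_approxStable` at `(0, 1)`; the rider dag-n22-w2 g4 offered, INBOX l.30134 — its own `…AtRecordReadOut` keeps `hlim` displayed).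

After this file the N22 row at the node-U3 object of record (plan g81 ruling (β)) reads, in ONE theorem: «towers `S` over def-T's catalogue read through `emb` with W1-20's law
`Localizes17OfRecord₁₃ F N θ S emb`; at every tower∕level W1's ACTIVITY slots `Bound238` ∧ `YoungLipschitz` (fading-memory weights `Λ (k+1) ·`) on prefix sets `∋ (g_0,…,g_k)`;
complexified probe readings `Φ` of the record's β-chart on open `U ⊇ ball 0 r` (chart clause, space clause, ACTIVITY holomorphy for every prefix of `Wk`); site weights with the p. 282
tails; Road-1 numerals (`0 < κ ≤ r₁`, `κ₀(64,8) ≤ κ∕4`, `2A e^{5r₁+1}K₀·9·64 ≤ 1`); `M = L^{m′}`; the small∕near class `lo` with (S≈); a letter block `ℓ` of the signs dominating the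
engine constants (`ℓ.κ ≤ δ₁`, `C_9·Λ ≤ ℓ.moduli`)» ⟹ `N22At` at the pinned bundle.  Every TERM-level and KERNEL-level law is DERIVED; what is displayed is activity-level (N10 ∕ NODE A),
the reading `Φ` and its tails (NODE A), (S≈) (NODE A ∕ def-W1), the law (NODE A ∕ N10), numerals.

HONEST FRAMING (binding).  Count-neutral composition (three one-line applications); THEOREMS ONLY (0 def, 0 sorry, standard axioms).  Nothing of Bałaban's is asserted or constructed;
no inhabitant at the datum of record is claimed (the hypotheses are LOCATED; the A6 witnesses of the two parent files are degenerate models); N22 is NOT discharged; K3⁷ is OPEN and NOT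
claimed; no count claim (the chair's single count line is the only count); one finite 𝕋⁴ programme at fixed ε — R4 closes the CONDITIONAL rung `BalabanLadder.UV` only; NOTHING about
the continuum limit, ℝ⁴, infinite volume, OS axioms, a mass gap or the Clay problem is proved or claimed by any of this.  No cite tags (Summit side); TYPES only: [I] = [Balaban1987RG1]
(1.7) p. 261, (1.18) p. 263, (1.20)–(1.21) p. 264, p. 282, (5.10) p. 293; [II] = [Balaban1988RG2Cluster] (2.13)–(2.14) pp. 14–15, Lemma 3 (2.38) p. 20.
-/

noncomputable section

open Filter Topology Metric Set
open scoped BigOperators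

namespace YMDAG.N22.AtKernels

open Literature.MathematicalPhysics.QuantumFieldTheory.Balaban1983to89
open Literature.MathematicalPhysics.QuantumFieldTheory.Balaban1983to89.T4Continuum (T4Family ULoop)
open Literature.MathematicalPhysics.QuantumFieldTheory.Balaban1983to89.T4OutputRate (Window NE9)
open Literature.MathematicalPhysics.QuantumFieldTheory.Balaban1983to89.Node00 (polScalar siteOfInt Stage13Params Stage13HParams U3Letters₁₁ MatA datumOfRecord₁₃CoPH)
open Literature.MathematicalPhysics.QuantumFieldTheory.Balaban1983to89.Node00.Sect2 (domCount domSys CPair)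
open Literature.MathematicalPhysics.QuantumFieldTheory.Balaban1983to89.Node00.W1 (ClusterTower)
open Literature.MathematicalPhysics.QuantumFieldTheory.Balaban1983to89.Node00.LocalizedSum17 (ReadingMaps Localizes17OfRecord₁₃)
open Literature.MathematicalPhysics.QuantumFieldTheory.Balaban1983to89.Node00.U3OfKernels (histPrefix objectsOfRecord₁₃ KernelDecayOfRecord₁₃)
open Literature.MathematicalPhysics.QuantumFieldTheory.Balaban1983to89.B12Decay510 (delta1)
open Literature.MathematicalPhysics.QuantumFieldTheory.Balaban1983to89.B12Decay510Window (K₁)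
open Literature.MathematicalPhysics.QuantumFieldTheory.Balaban1983to89.B12Decay510Torus (distCT nearT)
open Literature.MathematicalPhysics.QuantumFieldTheory.Balaban1983to89.B12TreeDecay (K₀ kappa₀ kappa₀_nonneg)
open Literature.MathematicalPhysics.QuantumFieldTheory.Balaban1983to89.TreeLengthTorus (TPt torusTreeLen)
open Literature.MathematicalPhysics.QuantumFieldTheory.Balaban1983to89.B12Sec2to5 (betaPrime510)
open YMDAG.UVSplit (N22At ReadOutAt u3OfRecord₁₃ RateReading₁₃CoPH rateCarriersOfRecord₁₃CoPH)
open Summit.QuantumFields.YangMills.BalabanUVNodes.N27ReadOutAtU3OfKernels (readOutAt_objectsOfRecord₁₃_coPH)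

open scoped Matrix.Norms.L2Operator

variable (F : T4Family) (N : ℕ) [NeZero N] {M : ℕ} [NeZero M]

/-- Numerals: Road 1's doubled smallness gives the single one (`A ≥ 0`), and `κ₀(64,8) ≤ κ∕4` with `κ ≥ 0` gives `κ₀(64,8) ≤ κ∕2`. -/
theorem numerals_of_doubled {A r₁ κ : ℝ} (hA : 0 ≤ A) (hκ0 : 0 ≤ κ) (hκ4 : kappa₀ (4 * 2 ^ 4) (2 * 4) ≤ κ / 2 / 2)
    (hsmall : 2 * A * Real.exp (5 * r₁ + 1) * K₀ 64 8 * 9 * 64 ≤ 1) :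
    A * Real.exp (5 * r₁ + 1) * K₀ 64 8 * 9 * 64 ≤ 1 ∧ kappa₀ (4 * 2 ^ 4) (2 * 4) ≤ κ / 2 := by
  have h0 : 0 ≤ A * Real.exp (5 * r₁ + 1) * K₀ 64 8 * 9 * 64 := by
    have := B12TreeDecay.K₀_pos (64 : ℝ) 8; positivity
  constructor <;> linarith

open Classical in
/-- ★★ **K3⁷ v5 §2b's `h9` FROM ACTIVITY-LEVEL INPUTS ALONE (existence discharged).**  dag-n22-w2 g3's `ne9_EA_objectsOfRecord₁₃_of_activitySlots` (p606885) with its `hlim` supplied by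
this seat's `polLimitsExistOfRecord₁₃_of_activitySlots`: the law, both W1 activity slots, the complexified readings (activity holomorphy for EVERY prefix of `Wk K k`), the tails, the
numerals (`0 < κ ≤ r₁`, `κ₀ ≤ κ∕4`, doubled smallness), the small∕near class with (S≈), and a dominating letter block ⟹ `NE9 ((objectsOfRecord₁₃ F N θ ℓ).EA 0) (Window θ.γ) ℓ.κ ℓ.moduli`.
LOCATED; nothing of the record claimed. -/
theorem ne9_EA_objectsOfRecord₁₃_of_activitySlots_of_approxStable (θ : Stage13Params F N) (ℓ : U3Letters₁₁) (hs : ℓ.Signs)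
    (m' : ℕ) (hM : M = F.L ^ m')
    (S : (K : ℕ) → ClusterTower (F.P K) (MatA N) M) (emb : ReadingMaps F (MatA N) (MatA N)) (hloc : Localizes17OfRecord₁₃ F N θ S emb)
    (Wk : (K k : ℕ) → Set (Fin (k + 1) → ℝ)) (hWk : ∀ g ∈ Window θ.γ, ∀ K k, histPrefix g k ∈ Wk K k)
    (sp : (K k : ℕ) → (domSys (F.P K) M (k + 1)).Dom → Set (CPair (F.P K) (MatA N))) {A R r₁ κ B₃ δ₀ r r₀ : ℝ} (Λ : ℕ → ℕ → ℝ)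
    (hA : 0 < A) (hr₁ : 0 ≤ r₁) (hκ0 : 0 < κ) (hκ : κ ≤ r₁) (hκ4 : kappa₀ (4 * 2 ^ 4) (2 * 4) ≤ κ / 2 / 2) (hrate : r₁ + 2 * (64 * Real.log 162) + 2 ≤ R)
    (hsmall : 2 * A * Real.exp (5 * r₁ + 1) * K₀ 64 8 * 9 * 64 ≤ 1) (hΛ : ∀ k i, 0 ≤ Λ k i) (hB₃ : 0 ≤ B₃) (hδ₀ : 0 < δ₀) (hr : 0 < r)
    (h238 : ∀ K k, ((S K) k).Bound238 (Wk K k) (sp K k) A R)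
    (hYL : ∀ K k, ((S K) k).YoungLipschitz (Wk K k) (sp K k) (fun i : Fin (k + 1) => Λ (k + 1) i) R)
    (Ec : ℕ → ℕ → Type*) [∀ K k, NormedAddCommGroup (Ec K k)] [∀ K k, NormedSpace ℂ (Ec K k)]
    (ιc : letI := θ.instVβ₁; letI := θ.instVβ₂; letI := θ.instιβ
      (K k : ℕ) → (domSys (F.P K) M (k + 1)).Dom → ((Fin (F.P K).d → Site (F.P K) (k + 1) → θ.Vβ) →L[ℝ] Ec K k))
    (Φ : (K k : ℕ) → (domSys (F.P K) M (k + 1)).Dom → Ec K k → CPair (F.P K) (MatA N))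
    (U : (K k : ℕ) → (domSys (F.P K) M (k + 1)).Dom → Set (Ec K k)) (hU : ∀ K k X, IsOpen (U K k X)) (hrU : ∀ K k X, ball (0 : Ec K k) r ⊆ U K k X)
    (hHhol : ∀ K k, ∀ hist ∈ Wk K k, ∀ (X Z : (domSys (F.P K) M (k + 1)).Dom), Z.1 ⊆ X.1 →
      DifferentiableOn ℂ (fun z => ((S K) k).H hist (Φ K k X z) Z) (U K k X))
    (hΦemb : letI := θ.instVβ₁; letI := θ.instVβ₂; letI := θ.instιβ
      ∀ K k X (B : Fin (F.P K).d → Site (F.P K) (k + 1) → θ.Vβ),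
        Φ K k X (ιc K k X B) = emb K k (fun l t => NormedSpace.exp (θ.ρ8 (B l t))))
    (hΦsp : ∀ K k X, ∀ z ∈ U K k X, ∀ Z : (domSys (F.P K) M (k + 1)).Dom, Z.1 ⊆ X.1 → Φ K k X z ∈ sp K k Z)
    (w : (K k : ℕ) → (domSys (F.P K) M (k + 1)).Dom → Site (F.P K) (k + 1) → ℝ) (hw₀ : ∀ K k X t, 0 ≤ w K k X t)
    (hw : letI := θ.instVβ₁; letI := θ.instVβ₂; letI := θ.instιβ
      ∀ K k X (l : Fin (F.P K).d) (t : Site (F.P K) (k + 1)) (c : θ.ιβ), ‖ιc K k X (Pi.single l (Pi.single t (θ.bV c)))‖ ≤ w K k X t)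
    (hwB : ∀ K k (X : (domSys (F.P K) M (k + 1)).Dom) (t : Site (F.P K) (k + 1)),
      w K k X t ≤ B₃ * Real.exp (-δ₀ * distCT (domCount (F.P K) M (k + 1)) M (fun i => (ZMod.cast (t i) : ZMod (domCount (F.P K) M (k + 1) * M)))
        (nearT (M := M) (fun i => (ZMod.cast (t i) : ZMod (domCount (F.P K) M (k + 1) * M))) X)))
    (lo : (k K : ℕ) → (domSys (F.P K) M (k + 1)).Dom → Prop) [∀ k K, DecidablePred (lo k K)]
    (hlo : ∀ (k K : ℕ) (X : (domSys (F.P K) M (k + 1)).Dom), ¬ lo k K X →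
      let e : Site (F.P K) (k + 1) → TPt 4 (domCount (F.P K) M (k + 1) * M) := fun x i => (ZMod.cast (x i) : ZMod (domCount (F.P K) M (k + 1) * M))
      (K : ℝ) ≤ torusTreeLen X.1 ∨ (K : ℝ) ≤ distCT (domCount (F.P K) M (k + 1)) M (e (siteOfInt F K (k + 1) 0)) (nearT (M := M) (e (siteOfInt F K (k + 1) 0)) X))
    (hr₀ : r₀ < 1) (hr₀' : 0 ≤ r₀)
    (hS : letI := θ.instVβ₁; letI := θ.instVβ₂; letI := θ.instιβ
      ∀ g ∈ Window θ.γ, ∀ (k : ℕ) (μ ν : Fin 4) (z : Fin 4 → ℤ), ∃ (K₀ : ℕ) (C : ℝ), ∀ K : ℕ, K₀ ≤ K →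
      |∑ X ∈ Finset.univ.filter (lo k (K + 1)), polScalar (fun U' => (((S (K + 1)) k).E (histPrefix g k) (emb (K + 1) k U') X).re) θ.ρ8 θ.bV (Fin.cast (F.P_d (K + 1)).symm μ) (siteOfInt F (K + 1) (k + 1) z) (Fin.cast (F.P_d (K + 1)).symm ν) (siteOfInt F (K + 1) (k + 1) 0) -
        ∑ X ∈ Finset.univ.filter (lo k K), polScalar (fun U' => (((S K) k).E (histPrefix g k) (emb K k U') X).re) θ.ρ8 θ.bV (Fin.cast (F.P_d K).symm μ) (siteOfInt F K (k + 1) z) (Fin.cast (F.P_d K).symm ν) (siteOfInt F K (k + 1) 0)| ≤ C * r₀ ^ K)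
    (hℓκ : ℓ.κ ≤ delta1 δ₀ κ ((M : ℝ) * 4))
    (hdom : ∀ k i, (16 * (8 * (Real.exp 1 * 9 * 64 * K₀ 64 8 ^ 2)) * B₃ ^ 2 / r ^ 2) *
        Real.exp (delta1 δ₀ κ ((M : ℝ) * 4) * ((M : ℝ) * 4) * 3) * K₀ (4 * 2 ^ 4) (2 * 4) * K₁ 4 (δ₀ / 2) * Λ k i ≤ ℓ.moduli k i) :
    NE9 ((objectsOfRecord₁₃ F N θ ℓ).EA 0) (Window θ.γ) ℓ.κ ℓ.moduli :=
  have hn := numerals_of_doubled hA.le hκ0.le hκ4 hsmall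
  YMDAG.N22.WindowSoftTwoPoint.ne9_EA_objectsOfRecord₁₃_of_activitySlots F N θ ℓ hs
    (polLimitsExistOfRecord₁₃_of_activitySlots F N θ m' hM S emb hloc Wk hWk sp hA.le hr₁ hκ0 hκ hκ4 hrate hn.1 hB₃ hδ₀ hr h238 Ec ιc Φ U hU hrU hHhol
      hΦemb hΦsp w hw₀ hw hwB lo hlo hr₀ hr₀' hS)
    m' M hM S emb hloc Wk hWk sp Λ hA hr₁ hκ hn.2 hrate hsmall hΛ hδ₀ hB₃ hr h238 hYL Ec ιc Φ U hU hrU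
    (fun g hg K k X Z hZ => hHhol K k _ (hWk g hg K k) X Z hZ) hΦemb hΦsp w hw₀ hw hwB hℓκ hdom

open Classical in
/-- ★★ **K3⁷ v5 §2b's `hdec` FROM ACTIVITY-LEVEL INPUTS ALONE (existence discharged; VALUE slot only).**  dag-n22-w2 g3's `kernelDecayOfRecord₁₃_of_activitySlots` with `hlim` from
`polLimitsExistOfRecord₁₃_of_activitySlots` ⟹ `KernelDecayOfRecord₁₃ F N θ μ ν κ′` for every entry and every `κ′ ≤ δ₁`.  LOCATED. -/
theorem kernelDecayOfRecord₁₃_of_activitySlots_of_approxStable (θ : Stage13Params F N)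
    (m' : ℕ) (hM : M = F.L ^ m')
    (S : (K : ℕ) → ClusterTower (F.P K) (MatA N) M) (emb : ReadingMaps F (MatA N) (MatA N)) (hloc : Localizes17OfRecord₁₃ F N θ S emb)
    (Wk : (K k : ℕ) → Set (Fin (k + 1) → ℝ)) (hWk : ∀ g ∈ Window θ.γ, ∀ K k, histPrefix g k ∈ Wk K k)
    (sp : (K k : ℕ) → (domSys (F.P K) M (k + 1)).Dom → Set (CPair (F.P K) (MatA N))) {A R r₁ κ B₃ δ₀ r r₀ : ℝ}
    (hA : 0 ≤ A) (hr₁ : 0 ≤ r₁) (hκ0 : 0 < κ) (hκ : κ ≤ r₁) (hκ4 : kappa₀ (4 * 2 ^ 4) (2 * 4) ≤ κ / 2 / 2) (hrate : r₁ + 2 * (64 * Real.log 162) + 2 ≤ R)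
    (hsmall : A * Real.exp (5 * r₁ + 1) * K₀ 64 8 * 9 * 64 ≤ 1) (hB₃ : 0 ≤ B₃) (hδ₀ : 0 < δ₀) (hr : 0 < r)
    (h238 : ∀ K k, ((S K) k).Bound238 (Wk K k) (sp K k) A R)
    (Ec : ℕ → ℕ → Type*) [∀ K k, NormedAddCommGroup (Ec K k)] [∀ K k, NormedSpace ℂ (Ec K k)]
    (ιc : letI := θ.instVβ₁; letI := θ.instVβ₂; letI := θ.instιβ
      (K k : ℕ) → (domSys (F.P K) M (k + 1)).Dom → ((Fin (F.P K).d → Site (F.P K) (k + 1) → θ.Vβ) →L[ℝ] Ec K k))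
    (Φ : (K k : ℕ) → (domSys (F.P K) M (k + 1)).Dom → Ec K k → CPair (F.P K) (MatA N))
    (U : (K k : ℕ) → (domSys (F.P K) M (k + 1)).Dom → Set (Ec K k)) (hU : ∀ K k X, IsOpen (U K k X)) (hrU : ∀ K k X, ball (0 : Ec K k) r ⊆ U K k X)
    (hHhol : ∀ K k, ∀ hist ∈ Wk K k, ∀ (X Z : (domSys (F.P K) M (k + 1)).Dom), Z.1 ⊆ X.1 →
      DifferentiableOn ℂ (fun z => ((S K) k).H hist (Φ K k X z) Z) (U K k X))
    (hΦemb : letI := θ.instVβ₁; letI := θ.instVβ₂; letI := θ.instιβ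
      ∀ K k X (B : Fin (F.P K).d → Site (F.P K) (k + 1) → θ.Vβ),
        Φ K k X (ιc K k X B) = emb K k (fun l t => NormedSpace.exp (θ.ρ8 (B l t))))
    (hΦsp : ∀ K k X, ∀ z ∈ U K k X, ∀ Z : (domSys (F.P K) M (k + 1)).Dom, Z.1 ⊆ X.1 → Φ K k X z ∈ sp K k Z)
    (w : (K k : ℕ) → (domSys (F.P K) M (k + 1)).Dom → Site (F.P K) (k + 1) → ℝ) (hw₀ : ∀ K k X t, 0 ≤ w K k X t)
    (hw : letI := θ.instVβ₁; letI := θ.instVβ₂; letI := θ.instιβ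
      ∀ K k X (l : Fin (F.P K).d) (t : Site (F.P K) (k + 1)) (c : θ.ιβ), ‖ιc K k X (Pi.single l (Pi.single t (θ.bV c)))‖ ≤ w K k X t)
    (hwB : ∀ K k (X : (domSys (F.P K) M (k + 1)).Dom) (t : Site (F.P K) (k + 1)),
      w K k X t ≤ B₃ * Real.exp (-δ₀ * distCT (domCount (F.P K) M (k + 1)) M (fun i => (ZMod.cast (t i) : ZMod (domCount (F.P K) M (k + 1) * M)))
        (nearT (M := M) (fun i => (ZMod.cast (t i) : ZMod (domCount (F.P K) M (k + 1) * M))) X)))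
    (lo : (k K : ℕ) → (domSys (F.P K) M (k + 1)).Dom → Prop) [∀ k K, DecidablePred (lo k K)]
    (hlo : ∀ (k K : ℕ) (X : (domSys (F.P K) M (k + 1)).Dom), ¬ lo k K X →
      let e : Site (F.P K) (k + 1) → TPt 4 (domCount (F.P K) M (k + 1) * M) := fun x i => (ZMod.cast (x i) : ZMod (domCount (F.P K) M (k + 1) * M))
      (K : ℝ) ≤ torusTreeLen X.1 ∨ (K : ℝ) ≤ distCT (domCount (F.P K) M (k + 1)) M (e (siteOfInt F K (k + 1) 0)) (nearT (M := M) (e (siteOfInt F K (k + 1) 0)) X))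
    (hr₀ : r₀ < 1) (hr₀' : 0 ≤ r₀)
    (hS : letI := θ.instVβ₁; letI := θ.instVβ₂; letI := θ.instιβ
      ∀ g ∈ Window θ.γ, ∀ (k : ℕ) (μ ν : Fin 4) (z : Fin 4 → ℤ), ∃ (K₀ : ℕ) (C : ℝ), ∀ K : ℕ, K₀ ≤ K →
      |∑ X ∈ Finset.univ.filter (lo k (K + 1)), polScalar (fun U' => (((S (K + 1)) k).E (histPrefix g k) (emb (K + 1) k U') X).re) θ.ρ8 θ.bV (Fin.cast (F.P_d (K + 1)).symm μ) (siteOfInt F (K + 1) (k + 1) z) (Fin.cast (F.P_d (K + 1)).symm ν) (siteOfInt F (K + 1) (k + 1) 0) -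
        ∑ X ∈ Finset.univ.filter (lo k K), polScalar (fun U' => (((S K) k).E (histPrefix g k) (emb K k U') X).re) θ.ρ8 θ.bV (Fin.cast (F.P_d K).symm μ) (siteOfInt F K (k + 1) z) (Fin.cast (F.P_d K).symm ν) (siteOfInt F K (k + 1) 0)| ≤ C * r₀ ^ K) {κ' : ℝ} (hκ' : κ' ≤ delta1 δ₀ κ ((M : ℝ) * 4)) (μ ν : Fin 4) :
    KernelDecayOfRecord₁₃ F N θ μ ν κ' :=
  have hκ2 : kappa₀ (4 * 2 ^ 4) (2 * 4) ≤ κ / 2 := by linarith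
  YMDAG.N22.WindowSoftTwoPoint.kernelDecayOfRecord₁₃_of_activitySlots F N θ
    (polLimitsExistOfRecord₁₃_of_activitySlots F N θ m' hM S emb hloc Wk hWk sp hA hr₁ hκ0 hκ hκ4 hrate hsmall hB₃ hδ₀ hr h238 Ec ιc Φ U hU hrU hHhol
      hΦemb hΦsp w hw₀ hw hwB lo hlo hr₀ hr₀' hS)
    m' M hM S emb hloc Wk hWk sp hA hr₁ hκ hκ2 hrate hsmall hδ₀ hB₃ hr h238 Ec ιc Φ U hU hrU
    (fun g hg K k X Z hZ => hHhol K k _ (hWk g hg K k) X Z hZ) hΦemb hΦsp w hw₀ hw hwB hκ' μ ν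

variable {N}

open Classical in
/-- ★★★ **THE N22 ROW AT (β), CLOSED MODULO ACTIVITY-LEVEL INPUTS: `N22At` BY NAME AT A KERNEL-PINNED READING OF RECORD, EVERY RUN LENGTH.**  For a Stage-13 rate reading `𝔯`
PINNED at the tuple to the kernel objects of record (`hpin` = K3⁷ v5's `U3PinnedKernels 𝔯 ℓ` read at `(F, θ, hP, g₀, os)`) with a letter block `ℓ` of the signs dominating the engine
constants: the towers∕reading with W1-20's law, W1's two ACTIVITY slots at every tower∕level, the complexified readings with holomorphic activities and p. 282 tails, Road-1 numerals,
`M = L^{m′}`, and the small∕near class with (S≈) give `N22At (rateCarriersOfRecord₁₃CoPH 𝔯 F θ hP g₀ os k).u3` for EVERY `k` — dag-n22-w2 g3's pin face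
`n22At_rateCarriers_of_kernels_pin_of_activitySlots` (p606885; this seat's g2 `n22At_rateCarriers_of_kernels_pin_of_ne9` inside) with `hlim` DISCHARGED by
`polLimitsExistOfRecord₁₃_of_activitySlots`.  LOCATED (hypothesis form); N22 NOT discharged; K3⁷ §2b `n22At_rrOfRecord_of_pinned` is this at the selector's value. -/
theorem n22At_rateCarriers_of_kernels_pin_of_activitySlots_of_approxStable (𝔯 : RateReading₁₃CoPH N) (θ : Stage13HParams F N) (hP : θ.Provisos₁₃CoPH F N)
    (g₀ : ℕ → ℝ) (os : List (ULoop F)) (ℓ : U3Letters₁₁) (hs : ℓ.Signs) (hpin : (𝔯.lit F θ hP g₀ os).u3 = objectsOfRecord₁₃ F N θ.toStage13Params ℓ)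
    (m' : ℕ) (hM : M = F.L ^ m')
    (S : (K : ℕ) → ClusterTower (F.P K) (MatA N) M) (emb : ReadingMaps F (MatA N) (MatA N)) (hloc : Localizes17OfRecord₁₃ F N θ.toStage13Params S emb)
    (Wk : (K k : ℕ) → Set (Fin (k + 1) → ℝ)) (hWk : ∀ g ∈ Window θ.γ, ∀ K k, histPrefix g k ∈ Wk K k)
    (sp : (K k : ℕ) → (domSys (F.P K) M (k + 1)).Dom → Set (CPair (F.P K) (MatA N))) {A R r₁ κ B₃ δ₀ r r₀ : ℝ} (Λ : ℕ → ℕ → ℝ)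
    (hA : 0 < A) (hr₁ : 0 ≤ r₁) (hκ0 : 0 < κ) (hκ : κ ≤ r₁) (hκ4 : kappa₀ (4 * 2 ^ 4) (2 * 4) ≤ κ / 2 / 2) (hrate : r₁ + 2 * (64 * Real.log 162) + 2 ≤ R)
    (hsmall : 2 * A * Real.exp (5 * r₁ + 1) * K₀ 64 8 * 9 * 64 ≤ 1) (hΛ : ∀ k i, 0 ≤ Λ k i) (hB₃ : 0 ≤ B₃) (hδ₀ : 0 < δ₀) (hr : 0 < r)
    (h238 : ∀ K k, ((S K) k).Bound238 (Wk K k) (sp K k) A R)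
    (hYL : ∀ K k, ((S K) k).YoungLipschitz (Wk K k) (sp K k) (fun i : Fin (k + 1) => Λ (k + 1) i) R)
    (Ec : ℕ → ℕ → Type*) [∀ K k, NormedAddCommGroup (Ec K k)] [∀ K k, NormedSpace ℂ (Ec K k)]
    (ιc : letI := θ.instVβ₁; letI := θ.instVβ₂; letI := θ.instιβ
      (K k : ℕ) → (domSys (F.P K) M (k + 1)).Dom → ((Fin (F.P K).d → Site (F.P K) (k + 1) → θ.Vβ) →L[ℝ] Ec K k))
    (Φ : (K k : ℕ) → (domSys (F.P K) M (k + 1)).Dom → Ec K k → CPair (F.P K) (MatA N))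
    (U : (K k : ℕ) → (domSys (F.P K) M (k + 1)).Dom → Set (Ec K k)) (hU : ∀ K k X, IsOpen (U K k X)) (hrU : ∀ K k X, ball (0 : Ec K k) r ⊆ U K k X)
    (hHhol : ∀ K k, ∀ hist ∈ Wk K k, ∀ (X Z : (domSys (F.P K) M (k + 1)).Dom), Z.1 ⊆ X.1 →
      DifferentiableOn ℂ (fun z => ((S K) k).H hist (Φ K k X z) Z) (U K k X))
    (hΦemb : letI := θ.instVβ₁; letI := θ.instVβ₂; letI := θ.instιβ
      ∀ K k X (B : Fin (F.P K).d → Site (F.P K) (k + 1) → θ.Vβ),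
        Φ K k X (ιc K k X B) = emb K k (fun l t => NormedSpace.exp (θ.ρ8 (B l t))))
    (hΦsp : ∀ K k X, ∀ z ∈ U K k X, ∀ Z : (domSys (F.P K) M (k + 1)).Dom, Z.1 ⊆ X.1 → Φ K k X z ∈ sp K k Z)
    (w : (K k : ℕ) → (domSys (F.P K) M (k + 1)).Dom → Site (F.P K) (k + 1) → ℝ) (hw₀ : ∀ K k X t, 0 ≤ w K k X t)
    (hw : letI := θ.instVβ₁; letI := θ.instVβ₂; letI := θ.instιβ
      ∀ K k X (l : Fin (F.P K).d) (t : Site (F.P K) (k + 1)) (c : θ.ιβ), ‖ιc K k X (Pi.single l (Pi.single t (θ.bV c)))‖ ≤ w K k X t)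
    (hwB : ∀ K k (X : (domSys (F.P K) M (k + 1)).Dom) (t : Site (F.P K) (k + 1)),
      w K k X t ≤ B₃ * Real.exp (-δ₀ * distCT (domCount (F.P K) M (k + 1)) M (fun i => (ZMod.cast (t i) : ZMod (domCount (F.P K) M (k + 1) * M)))
        (nearT (M := M) (fun i => (ZMod.cast (t i) : ZMod (domCount (F.P K) M (k + 1) * M))) X)))
    (lo : (k K : ℕ) → (domSys (F.P K) M (k + 1)).Dom → Prop) [∀ k K, DecidablePred (lo k K)]
    (hlo : ∀ (k K : ℕ) (X : (domSys (F.P K) M (k + 1)).Dom), ¬ lo k K X →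
      let e : Site (F.P K) (k + 1) → TPt 4 (domCount (F.P K) M (k + 1) * M) := fun x i => (ZMod.cast (x i) : ZMod (domCount (F.P K) M (k + 1) * M))
      (K : ℝ) ≤ torusTreeLen X.1 ∨ (K : ℝ) ≤ distCT (domCount (F.P K) M (k + 1)) M (e (siteOfInt F K (k + 1) 0)) (nearT (M := M) (e (siteOfInt F K (k + 1) 0)) X))
    (hr₀ : r₀ < 1) (hr₀' : 0 ≤ r₀)
    (hS : letI := θ.instVβ₁; letI := θ.instVβ₂; letI := θ.instιβ
      ∀ g ∈ Window θ.γ, ∀ (k : ℕ) (μ ν : Fin 4) (z : Fin 4 → ℤ), ∃ (K₀ : ℕ) (C : ℝ), ∀ K : ℕ, K₀ ≤ K →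
      |∑ X ∈ Finset.univ.filter (lo k (K + 1)), polScalar (fun U' => (((S (K + 1)) k).E (histPrefix g k) (emb (K + 1) k U') X).re) θ.ρ8 θ.bV (Fin.cast (F.P_d (K + 1)).symm μ) (siteOfInt F (K + 1) (k + 1) z) (Fin.cast (F.P_d (K + 1)).symm ν) (siteOfInt F (K + 1) (k + 1) 0) -
        ∑ X ∈ Finset.univ.filter (lo k K), polScalar (fun U' => (((S K) k).E (histPrefix g k) (emb K k U') X).re) θ.ρ8 θ.bV (Fin.cast (F.P_d K).symm μ) (siteOfInt F K (k + 1) z) (Fin.cast (F.P_d K).symm ν) (siteOfInt F K (k + 1) 0)| ≤ C * r₀ ^ K)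
    (hℓκ : ℓ.κ ≤ delta1 δ₀ κ ((M : ℝ) * 4))
    (hdom : ∀ k i, (16 * (8 * (Real.exp 1 * 9 * 64 * K₀ 64 8 ^ 2)) * B₃ ^ 2 / r ^ 2) *
        Real.exp (delta1 δ₀ κ ((M : ℝ) * 4) * ((M : ℝ) * 4) * 3) * K₀ (4 * 2 ^ 4) (2 * 4) * K₁ 4 (δ₀ / 2) * Λ k i ≤ ℓ.moduli k i) (k : ℕ) :
    N22At (rateCarriersOfRecord₁₃CoPH 𝔯 F θ hP g₀ os k).u3 :=
  have hn := numerals_of_doubled hA.le hκ0.le hκ4 hsmall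
  YMDAG.N22.WindowSoftTwoPoint.n22At_rateCarriers_of_kernels_pin_of_activitySlots F N 𝔯 θ hP g₀ os ℓ hs hpin
    (polLimitsExistOfRecord₁₃_of_activitySlots F N θ.toStage13Params m' hM S emb hloc Wk hWk sp hA.le hr₁ hκ0 hκ hκ4 hrate hn.1 hB₃ hδ₀ hr h238 Ec ιc Φ U hU
      hrU hHhol hΦemb hΦsp w hw₀ hw hwB lo hlo hr₀ hr₀' hS)
    m' M hM S emb hloc Wk hWk sp Λ hA hr₁ hκ hn.2 hrate hsmall hΛ hδ₀ hB₃ hr h238 hYL Ec ιc Φ U hU hrU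
    (fun g hg K k X Z hZ => hHhol K k _ (hWk g hg K k) X Z hZ) hΦemb hΦsp w hw₀ hw hwB hℓκ hdom k

open Classical in
/-- ★★★ **THE (D4) READ-OUT FACE AT A KERNEL-PINNED READING, EVERY RUN LENGTH, FROM ACTIVITY-LEVEL INPUTS (existence discharged; VALUE slot only).**  Under the pin `hpin`, a letter
block with its signs, `0 < ℓ.κ ≤ δ₁` and the (5.10) domination row `betaPrime510 4 1 ℓ.κ ≤ ℓ.cr`: the law, W1's (2.38) value slot at every tower∕level, the complexified readings with
holomorphic activities and p. 282 tails, Road-1 numerals (single smallness), `M = L^{m′}` and the small∕near class with (S≈) give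
`ReadOutAt (datumOfRecord₁₃CoPH F N θ hP) (rateCarriersOfRecord₁₃CoPH 𝔯 F θ hP g₀ os k).u3` — dag-n27-w1's `readOutAt_objectsOfRecord₁₃_coPH` (p591653) fed with
`kernelDecayOfRecord₁₃_of_activitySlots_of_approxStable` at the entry `(0, 1)` (K3⁷ v5 §2b `readOutAt_rrOfRecord_of_pinned` at the selector's value, in ACTIVITY currency, `hlim`-free).
LOCATED; (D4) NOT discharged. -/
theorem readOutAt_rateCarriers_of_kernels_pin_of_activitySlots_of_approxStable (𝔯 : RateReading₁₃CoPH N) (θ : Stage13HParams F N) (hP : θ.Provisos₁₃CoPH F N)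
    (g₀ : ℕ → ℝ) (os : List (ULoop F)) (ℓ : U3Letters₁₁) (hs : ℓ.Signs) (hℓ₀ : 0 < ℓ.κ) (hcr : betaPrime510 4 1 ℓ.κ ≤ ℓ.cr)
    (hpin : (𝔯.lit F θ hP g₀ os).u3 = objectsOfRecord₁₃ F N θ.toStage13Params ℓ)
    (m' : ℕ) (hM : M = F.L ^ m')
    (S : (K : ℕ) → ClusterTower (F.P K) (MatA N) M) (emb : ReadingMaps F (MatA N) (MatA N)) (hloc : Localizes17OfRecord₁₃ F N θ.toStage13Params S emb)
    (Wk : (K k : ℕ) → Set (Fin (k + 1) → ℝ)) (hWk : ∀ g ∈ Window θ.γ, ∀ K k, histPrefix g k ∈ Wk K k)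
    (sp : (K k : ℕ) → (domSys (F.P K) M (k + 1)).Dom → Set (CPair (F.P K) (MatA N))) {A R r₁ κ B₃ δ₀ r r₀ : ℝ}
    (hA : 0 ≤ A) (hr₁ : 0 ≤ r₁) (hκ0 : 0 < κ) (hκ : κ ≤ r₁) (hκ4 : kappa₀ (4 * 2 ^ 4) (2 * 4) ≤ κ / 2 / 2) (hrate : r₁ + 2 * (64 * Real.log 162) + 2 ≤ R)
    (hsmall : A * Real.exp (5 * r₁ + 1) * K₀ 64 8 * 9 * 64 ≤ 1) (hB₃ : 0 ≤ B₃) (hδ₀ : 0 < δ₀) (hr : 0 < r)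
    (h238 : ∀ K k, ((S K) k).Bound238 (Wk K k) (sp K k) A R)
    (Ec : ℕ → ℕ → Type*) [∀ K k, NormedAddCommGroup (Ec K k)] [∀ K k, NormedSpace ℂ (Ec K k)]
    (ιc : letI := θ.instVβ₁; letI := θ.instVβ₂; letI := θ.instιβ
      (K k : ℕ) → (domSys (F.P K) M (k + 1)).Dom → ((Fin (F.P K).d → Site (F.P K) (k + 1) → θ.Vβ) →L[ℝ] Ec K k))
    (Φ : (K k : ℕ) → (domSys (F.P K) M (k + 1)).Dom → Ec K k → CPair (F.P K) (MatA N))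
    (U : (K k : ℕ) → (domSys (F.P K) M (k + 1)).Dom → Set (Ec K k)) (hU : ∀ K k X, IsOpen (U K k X)) (hrU : ∀ K k X, ball (0 : Ec K k) r ⊆ U K k X)
    (hHhol : ∀ K k, ∀ hist ∈ Wk K k, ∀ (X Z : (domSys (F.P K) M (k + 1)).Dom), Z.1 ⊆ X.1 →
      DifferentiableOn ℂ (fun z => ((S K) k).H hist (Φ K k X z) Z) (U K k X))
    (hΦemb : letI := θ.instVβ₁; letI := θ.instVβ₂; letI := θ.instιβ
      ∀ K k X (B : Fin (F.P K).d → Site (F.P K) (k + 1) → θ.Vβ),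
        Φ K k X (ιc K k X B) = emb K k (fun l t => NormedSpace.exp (θ.ρ8 (B l t))))
    (hΦsp : ∀ K k X, ∀ z ∈ U K k X, ∀ Z : (domSys (F.P K) M (k + 1)).Dom, Z.1 ⊆ X.1 → Φ K k X z ∈ sp K k Z)
    (w : (K k : ℕ) → (domSys (F.P K) M (k + 1)).Dom → Site (F.P K) (k + 1) → ℝ) (hw₀ : ∀ K k X t, 0 ≤ w K k X t)
    (hw : letI := θ.instVβ₁; letI := θ.instVβ₂; letI := θ.instιβ
      ∀ K k X (l : Fin (F.P K).d) (t : Site (F.P K) (k + 1)) (c : θ.ιβ), ‖ιc K k X (Pi.single l (Pi.single t (θ.bV c)))‖ ≤ w K k X t)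
    (hwB : ∀ K k (X : (domSys (F.P K) M (k + 1)).Dom) (t : Site (F.P K) (k + 1)),
      w K k X t ≤ B₃ * Real.exp (-δ₀ * distCT (domCount (F.P K) M (k + 1)) M (fun i => (ZMod.cast (t i) : ZMod (domCount (F.P K) M (k + 1) * M)))
        (nearT (M := M) (fun i => (ZMod.cast (t i) : ZMod (domCount (F.P K) M (k + 1) * M))) X)))
    (lo : (k K : ℕ) → (domSys (F.P K) M (k + 1)).Dom → Prop) [∀ k K, DecidablePred (lo k K)]
    (hlo : ∀ (k K : ℕ) (X : (domSys (F.P K) M (k + 1)).Dom), ¬ lo k K X →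
      let e : Site (F.P K) (k + 1) → TPt 4 (domCount (F.P K) M (k + 1) * M) := fun x i => (ZMod.cast (x i) : ZMod (domCount (F.P K) M (k + 1) * M))
      (K : ℝ) ≤ torusTreeLen X.1 ∨ (K : ℝ) ≤ distCT (domCount (F.P K) M (k + 1)) M (e (siteOfInt F K (k + 1) 0)) (nearT (M := M) (e (siteOfInt F K (k + 1) 0)) X))
    (hr₀ : r₀ < 1) (hr₀' : 0 ≤ r₀)
    (hS : letI := θ.instVβ₁; letI := θ.instVβ₂; letI := θ.instιβ
      ∀ g ∈ Window θ.γ, ∀ (k : ℕ) (μ ν : Fin 4) (z : Fin 4 → ℤ), ∃ (K₀ : ℕ) (C : ℝ), ∀ K : ℕ, K₀ ≤ K →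
      |∑ X ∈ Finset.univ.filter (lo k (K + 1)), polScalar (fun U' => (((S (K + 1)) k).E (histPrefix g k) (emb (K + 1) k U') X).re) θ.ρ8 θ.bV (Fin.cast (F.P_d (K + 1)).symm μ) (siteOfInt F (K + 1) (k + 1) z) (Fin.cast (F.P_d (K + 1)).symm ν) (siteOfInt F (K + 1) (k + 1) 0) -
        ∑ X ∈ Finset.univ.filter (lo k K), polScalar (fun U' => (((S K) k).E (histPrefix g k) (emb K k U') X).re) θ.ρ8 θ.bV (Fin.cast (F.P_d K).symm μ) (siteOfInt F K (k + 1) z) (Fin.cast (F.P_d K).symm ν) (siteOfInt F K (k + 1) 0)| ≤ C * r₀ ^ K) (hℓκ : ℓ.κ ≤ delta1 δ₀ κ ((M : ℝ) * 4)) (k : ℕ) :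
    ReadOutAt (datumOfRecord₁₃CoPH F N θ hP) (rateCarriersOfRecord₁₃CoPH 𝔯 F θ hP g₀ os k).u3 := by
  show ReadOutAt (datumOfRecord₁₃CoPH F N θ hP) (u3OfRecord₁₃ θ.toStage13Params (𝔯.lit F θ hP g₀ os).u3 k)
  rw [hpin]
  exact readOutAt_objectsOfRecord₁₃_coPH θ hP ℓ hs hℓ₀ hcr k
    (kernelDecayOfRecord₁₃_of_activitySlots_of_approxStable F N θ.toStage13Params m' hM S emb hloc Wk hWk sp hA hr₁ hκ0 hκ hκ4 hrate hsmall hB₃ hδ₀ hr h238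
      Ec ιc Φ U hU hrU hHhol hΦemb hΦsp w hw₀ hw hwB lo hlo hr₀ hr₀' hS hℓκ 0 1)

end YMDAG.N22.AtKernels

end
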